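import Summits.BirchSwinnertonDyer.BirchSwinnertonDyer.Theses.BiquadraticEisensteinDescent
import Summits.BirchSwinnertonDyer.Rank1Residual.X11b.BDPRouteOpenInputIdealRigidity
import Summits.BirchSwinnertonDyer.Rank1Residual.X11b.AnticyclotomicModuleFinite
import Summits.BirchSwinnertonDyer.BirchSwinnertonDyer.Theorems.BiquadraticEisensteinDescentEisensteinHeartFlatCMInertBadKPrimeCMDatumAdapter
import Summits.BirchSwinnertonDyer.BirchSwinnertonDyer.Theorems.BiquadraticEisensteinDescentEisensteinHeartFlatCMInertBadKPrimeSqrtEndomorphismAllJ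
import HarnessLib

/-!
# Skeleton `hsieh-lambda` v2.2 (= v2.1 with `stub_sqrtEndomorphism` CLOSED) for crux `EisensteinHeartFlatCMInertBadKPrime` — the ♭-HEART over `K′`
# (item stmt-BirchSwinnertonDyer-21341, route `BiquadraticEisensteinDescent` rev 25, rank 201; D-0152 move M1)

Lead-prover seat `bsd-wall-cm-bed-p1` g0 (cycle 2, 2026-08-28T08:5xZ). v1/v1.1 (eafa30ec320c3e1d) had two stubs: `stub_hsiehWitness`
(closed conditionally, p594900) and `stub_divHsiehWitness` = the λ-part Greenberg–BDP divisibility for Hsieh witnesses over `K′`.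
v2 CUTS `stub_divHsiehWitness` along the layer-2 work landed by the width seats (w1 g0/g5: E1c algebra + V3 Shapiro datum,
21 helper files; w3 g5/g6: V1 Katz frames + V2 Katz–Hsieh socket; w2 g6/g7: the biquadratic CM field `L = K′·K_CM` in tree
terms; w4: kit + the He–Wei 2025 / Hsieh 2012 print heads) into

  `stub_sqrtEndomorphism` (M): the geometric CM endomorphism `ψ = [√d_CM]` of `W(K̄′)` with its Galois sign rules
  (`σ ∘ ψ = ±ψ ∘ σ` by `σ(√d_CM)/√d_CM`, `ψ² = d_CM`), `√d_CM ∉ K′`, `d_CM` a non-square mod `p` — the input of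
  `…CMDatumAdapter.heartShape_xac_of_sqrt_endomorphism` (w1 g5). CLOSED for the seven `j` with odd class-number-one `d_K`
  (`…SqrtEndomorphismTwist.exists_sqrt_endomorphism_of_j_mem`, w1 g5) up to the two arithmetic side facts
  (`√d_CM ∉ K′`: `…BiquadraticPrimes.sqrt_not_mem_range`; non-square: `…BiquadraticPrimes.not_isSquare_of_cmInert`, w2 g6);
  OPEN for `j ∈ {0, 1728, 54000, −12288000, 287496, 8000}` (sextic/quartic twists and the non-maximal orders).
  `stub_V4` (XL, THE INPUT, now stated WHERE HSIEH'S THEOREM LIVES): for the `𝒪⟦T⟧`-module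
  `N = X_L(ψ̂_L) = WithQuadratic (LocNilDual Sel_{L·K′_∞} …)` — the Pontryagin dual of Castella's Selmer group of `W` over the
  tower `L·K′_∞` (`U = Γ_L = Stab(√d_CM)`), strict at the primes over `𝔭′`, with its `𝒪 = ℤ_p[√d_CM]`-structure from `[√d_CM]` —
  `∃ m, p^m · Ch_{𝒪⟦T⟧}(N) · 𝓞_{ℂ_p}⟦T⟧ ⊆ (Q_H)` for every Hsieh witness `Q_H` (the `hV4` hypothesis of the one-call V3 theorem,
  universally quantified over its admissible data): this is the `ψ_L`-branch object of Hsieh JAMS14 Thm 8.14 (`Σ_p = {𝔓′}`) on the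
  `K′`-anticyclotomic line, read in `Λ ⊗ ℚ` (μ-blind). Further cut foreseen (v3, not registered): `stub_V4 ⇐ stub_V4K` (the same
  for KATZ line frames `G`, `KatzCM.IsBaseChangeLine`, w3) `∧ stub_V2` (`(c·G) = (c′·Q_H)`, w3's `…KatzHsiehSocket` modulo the Katz
  existence fact, (L) automorphic induction — w3 g6 p616514/p617166 — and Hsieh's (d2) `ϑ`, w2 g6 ADDENDUM 3).

Composition `EisensteinHeartFlatCMInertBadKPrime_of` (kernel-checked): Hsieh witness (stub 1) → `[√d_CM]` datum (stub 2) →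
`U := Stab_{Γ_{K′}}(√d_CM)` (open, normal, index 2: `…CMDatumAdapter`) → `heartShape_xac_of_sqrt_endomorphism` with `hV4 := stub_V4`
(V3 = w1's `…ShapiroDatumPackaged`, all algebraic sockets inhabited; `X_ac` f.g. by `X11b.AcSelmer.XAc.module_finite_empty`) →
heart shape for `(X_ac, Q_H)` → every ♭-frame `Q` by the PROVED ideal rigidity
`X11b.span_singleton_eq_of_isHsiehLFunction_of_isBDPLFunctionInt` (`p ∣ N_W`, `p ≠ 2`).

Status: lean rc 0, sorries 2 = stubs `stub_hsiehWitness` (cond. closed p594900) and `stub_V4`; `stub_sqrtEndomorphism` is a theorem (v2.2); BSD is not proved by any of this; `stub_V4` is NOT in print (HSIEH-AWAY-FROM-P-AUDIT.md (C3);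
PART 2 by w2; the tame root number at `𝔓` is a p-adic unit, §E).
-/

set_option linter.dupNamespace false
set_option autoImplicit false

noncomputable section

open scoped Classical NumberField

open WeierstrassCurve NumberField IsDedekindDomain Field PowerSeries
  Literature.NumberTheory.EllipticCurves Literature.NumberTheory.EllipticCurves.ModularForms
  Literature.NumberTheory.EllipticCurves.Rank1Residual
  Literature.NumberTheory.EllipticCurves.Hsieh2014
  Literature.NumberTheory.EllipticCurves.GreenbergSelmer
  Literature.NumberTheory.EllipticCurves.Module
  Literature.NumberTheory.EllipticCurves.IwasawaDual
  Literature.NumberTheory.GaloisRepresentations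
  Summit.BirchSwinnertonDyer.Rank1Residual Summit.BirchSwinnertonDyer.Rank1Residual.X11b
  Summit.BirchSwinnertonDyer.Rank1Residual.X11b.AcSelmer
  Summit.BirchSwinnertonDyer.BirchSwinnertonDyer.Theorems.BiquadraticEisensteinDescentDefs
  Summit.BirchSwinnertonDyer.BirchSwinnertonDyer.Theorems.BiquadraticEisensteinDescentEisensteinHeartFlatCMInertBadKPrimeSelmerTower
  Summit.BirchSwinnertonDyer.BirchSwinnertonDyer.Theorems.BiquadraticEisensteinDescentEisensteinHeartFlatCMInertBadKPrimeShapiroDatum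
  Summit.BirchSwinnertonDyer.BirchSwinnertonDyer.Theorems.BiquadraticEisensteinDescentEisensteinHeartFlatCMInertBadKPrimeCMDatumAdapter

namespace Summit.BirchSwinnertonDyer.BirchSwinnertonDyer.Cruxes.EisensteinHeartFlatCMInertBadKPrime.HsiehLambda

open Summit.BirchSwinnertonDyer.BirchSwinnertonDyer.Theses.BiquadraticEisensteinDescent
open Summit.BirchSwinnertonDyer.BirchSwinnertonDyer.Theorems.BiquadraticEisensteinDescentEisensteinHeartFlatCMInertBadKPrimeCMDatumAdapter

/-- STUB `stub_hsiehWitness` (S — BY-NAME PRINT INPUT, Hsieh Doc. Math. 19 (2014) Thm A AT ANY LEVEL): for `W/ℚ`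
with `p ≥ 5` a bad prime, `K = K′` imaginary quadratic satisfying the Heegner hypothesis for `N_W` (so `p` splits),
an anticyclotomic `ℤ_p`-extension `κ` with topological generator `γ`, a prime `𝔭 ∋ p` of `K′`, a newform `f` of
`W` and an isomorphism `ι′ : ℚ̄_p ≃ ℂ` compatible with `𝔭`, there is a HSIEH WITNESS `(A, Ω_K′, C, Ω_p, Q_H)`:
`0 < A`, `Ω_K′ ≠ 0`, `‖ι′⁻¹C‖ = 1`, `Ω_p ∈ R₀ˣ`, `IsHsiehLFunction ι′ 𝔭 κ γ f A Ω_K′ C Ω_p Q_H` (the square of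
Hsieh's `𝒫_Σ(π_f, λ)` in the twisted variable, `λ` from the tree's λ-supply). Status: = the route's held print
input `HsiehAnyLevelInput` (item 20456, `Hsieh2014.thmA_exists_isHsiehLFunction_unrPeriod_anyLevel`) instantiated
through the THEOREM `X11b.lambdaSupplyAt`; closes conditionally on that named fact in three lines (helper file
`Theorems/BiquadraticEisensteinDescentEisensteinHeartFlatCMInertBadKPrimeHsiehWitness.lean`); unconditional only by
formalising Thm A. Leans on: Hsieh2014 Thm A (unproved named fact). -/
theorem stub_hsiehWitness :
    ∀ (W : WeierstrassCurve ℚ) [W.IsElliptic] [W.IsGloballyMinimal] (p : ℕ) [Fact p.Prime]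
      [NeZero (W.conductorNorm ℤ)] (K : Type) [Field K] [NumberField K],
      5 ≤ p → ¬ Good W p → IsImaginaryQuadratic K → SatisfiesHeegnerHypothesis (W.conductorNorm ℤ) K →
      ∀ (κ : ZpExtension K p), κ.IsAnticyclotomic →
        ∀ (γ : Field.absoluteGaloisGroup K) [Fact (κ.IsTopGenerator γ)]
          (𝔭 : HeightOneSpectrum (𝓞 K)), ((p : ℕ) : 𝓞 K) ∈ 𝔭.asIdeal →
          ∀ (f : CuspForm (CongruenceSubgroup.Gamma0 (W.conductorNorm ℤ)) 2), IsNewformOf W f →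
            ∀ (ι' : PadicAlgCl p ≃+* ℂ),
              (∀ (w : InfinitePlace K) (k : 𝓞 K), k ∈ 𝔭.asIdeal ↔ ‖ι'.symm (w.embedding (k : K))‖ < 1) →
              ∃ (A : ℝ) (ΩK C : ℂ) (Ωp : (unrIntegers p)ˣ) (QH : PowerSeries (PadicComplexInt p)),
                0 < A ∧ ΩK ≠ 0 ∧ ‖((ι'.symm C : PadicAlgCl p) : ℂ_[p])‖ = 1 ∧
                  IsHsiehLFunction ι' 𝔭 κ γ f A ΩK C ((Ωp : unrIntegers p) : ℂ_[p]) QH := by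
  sorry

/-- STUB `stub_sqrtEndomorphism` (M — the CM endomorphism `[√d_CM]` in Galois-action form over `K′`): for `W/ℚ` CM, `p ≥ 5`
CM-inert and bad, `K = K′` imaginary quadratic Heegner for `N_W`, and two distinct primes `𝔭, 𝔭′ ∋ p` of `K′` (the crux's
binders; they witness that `p` splits in `K′`): there are `d₀ : ℤ` (= `d_CM`), `r ∈ K̄′` with `r² = d₀`,
`r ∉ K′` (`p` splits in `K′` but is inert in `ℚ(√d₀)`), `d₀` a non-square mod `p`, and an additive `ψ` on `W(K̄′)` with
`σ ∘ ψ = ψ ∘ σ` if `σ r = r`, `σ ∘ ψ = −ψ ∘ σ` if `σ r = −r`, and `ψ ∘ ψ = d₀` (Silverman, *Advanced Topics* II §2, Thm II.2.2(b)).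
Status: the input of `…CMDatumAdapter.heartShape_xac_of_sqrt_endomorphism` (w1 g5); CLOSED for the seven class-number-one `j ≠ 0, 1728`
by `…SqrtEndomorphismTwist.exists_sqrt_endomorphism_of_j_mem` + `…BiquadraticPrimes.sqrt_not_mem_range` / `not_isSquare_of_cmInert`
(w2 g6) up to assembling; v2.2 (width seat `bsd-wall-cm-bed-w4` g7): CLOSED for ALL thirteen `j` by
`…SqrtEndomorphismAllJ.stub_sqrtEndomorphism` (p621092; `j = 0, 1728` generic formulas p619150, `j = 54000` p619765, `j = 8000, 287496` even-degree
engine p620586, `j = −12288000` w1 g5 p618659, the seven certified `j` = lead p618285). -/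
theorem stub_sqrtEndomorphism :
    ∀ (W : WeierstrassCurve ℚ) [W.IsElliptic] [W.IsGloballyMinimal] (p : ℕ) [Fact p.Prime]
      [NeZero (W.conductorNorm ℤ)] (K : Type) [Field K] [NumberField K],
      W.HasCM → 5 ≤ p → CMInert W p → ¬ Good W p →
      IsImaginaryQuadratic K → SatisfiesHeegnerHypothesis (W.conductorNorm ℤ) K →
      ∀ (𝔭 𝔭' : HeightOneSpectrum (𝓞 K)), ((p : ℕ) : 𝓞 K) ∈ 𝔭.asIdeal → ((p : ℕ) : 𝓞 K) ∈ 𝔭'.asIdeal → 𝔭' ≠ 𝔭 →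
      ∃ (d₀ : ℤ) (r : AlgebraicClosure K) (ψ : (W.baseChange K).geomPoints →+ (W.baseChange K).geomPoints),
        r * r = algebraMap K (AlgebraicClosure K) (d₀ : K) ∧
        r ∉ Set.range (algebraMap K (AlgebraicClosure K)) ∧
        (∀ y : ZMod p, y * y ≠ PadicInt.toZMod ((d₀ : ℤ) : ℤ_[p])) ∧
        (∀ σ : absoluteGaloisGroup K, σ • r = r → ∀ P : (W.baseChange K).geomPoints, σ • ψ P = ψ (σ • P)) ∧
        (∀ σ : absoluteGaloisGroup K, σ • r = -r → ∀ P : (W.baseChange K).geomPoints, σ • ψ P = -ψ (σ • P)) ∧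
        (∀ P, ψ (ψ P) = d₀ • P) :=
  Summit.BirchSwinnertonDyer.BirchSwinnertonDyer.Theorems.BiquadraticEisensteinDescentEisensteinHeartFlatCMInertBadKPrimeSqrtEndomorphismAllJ.stub_sqrtEndomorphism

/-- STUB `stub_V4` (XL — THE INPUT of the line, stated on the CM side): for `W/ℚ` CM, `p ≥ 5` CM-inert and bad, `K = K′` Heegner with
`|d| > 4`, `p ∤ h(K′)`, `(κ, γ)` anticyclotomic, `𝔭` degree one, newform `f`, compatible `ι′`, every Hsieh witness `Q_H` at `𝔭`, the other
prime `𝔭′`, `X_ac(W/K′)_{𝔭′-str}` Λ-torsion, every `[√d₀]` datum `(d₀, r, ψ)` as in `stub_sqrtEndomorphism` and `U = {σ | σ r = r} = Γ_L`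
(`L = K′(√d₀) = K′·K_CM`): for EVERY admissible `(φ = ψ|W[p^∞], γ′ ∈ U, f₁, h, δ, b, ι)` (the data of w1's one-call V3 theorem),
`∃ m, p^m · Ch_{𝒪⟦T⟧}(N) · 𝓞_{ℂ_p}⟦T⟧ ⊆ (Q_H)` with `𝒪 = ℤ_p[X]/(X² − d₀)` and
`N = WithQuadratic (LocNilDual Sel(L·K′_∞; strict above 𝔭′) f₁ h) b … δ …` = the `ψ_L`-branch Iwasawa module `X_L(ψ̂_L)` of Hsieh JAMS14
Thm 8.14 (`Σ_p = {𝔓′}`) along the `K′`-line, with its `𝒪⟦T⟧`-structure from `[√d₀]`. Why it might fail / status: NOT IN PRINT — Hsieh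
JAMS 27 (2014) §§4–8 on the `p`-RAMIFIED tame level-2 branch `ψ_W∘N_{L/K_CM}`; residue (C3) of HSIEH-AWAY-FROM-P-AUDIT.md (+ PART 2, w2):
a Fourier–Jacobi coefficient of `𝓔^ord(Ψ|1,𝔫)` non-zero mod `P` for `P ≠ (ϖ)` (equivalently p-primitive up to the tame Gauss sum, whose
unitary normalisation is a p-adic UNIT by §E); the Katz–Hsieh comparison (V2, w3: `…KatzHsiehSocket`, modulo the Katz existence fact,
automorphic induction (L) and Hsieh's (d2) `ϑ`) moves `Q_H` to the Katz line frame where the Eisenstein constant term lives. -/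
theorem stub_V4 :
    ∀ (W : WeierstrassCurve ℚ) [W.IsElliptic] [W.IsGloballyMinimal] (p : ℕ) [Fact p.Prime]
      [NeZero (W.conductorNorm ℤ)] (K : Type) [Field K] [NumberField K],
      W.HasCM → 5 ≤ p → CMInert W p → ¬ Good W p →
      IsImaginaryQuadratic K → SatisfiesHeegnerHypothesis (W.conductorNorm ℤ) K →
      4 < (NumberField.discr K).natAbs → ¬ p ∣ NumberField.classNumber K →
      ∀ (κ : ZpExtension K p), κ.IsAnticyclotomic →
        ∀ (γ : Field.absoluteGaloisGroup K) [Fact (κ.IsTopGenerator γ)]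
          (𝔭 : HeightOneSpectrum (𝓞 K)), ((p : ℕ) : 𝓞 K) ∈ 𝔭.asIdeal →
          𝔭.asIdeal.ramificationIdx (𝓞 ℚ) = 1 → 𝔭.asIdeal.inertiaDeg (𝓞 ℚ) = 1 →
          ∀ (f : CuspForm (CongruenceSubgroup.Gamma0 (W.conductorNorm ℤ)) 2), IsNewformOf W f →
            ∀ (ι' : PadicAlgCl p ≃+* ℂ),
              (∀ (w : InfinitePlace K) (k : 𝓞 K), k ∈ 𝔭.asIdeal ↔ ‖ι'.symm (w.embedding (k : K))‖ < 1) →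
              ∀ (A : ℝ) (ΩK C : ℂ) (Ωp : (unrIntegers p)ˣ) (QH : PowerSeries (PadicComplexInt p)),
                0 < A → ΩK ≠ 0 → ‖((ι'.symm C : PadicAlgCl p) : ℂ_[p])‖ = 1 →
                IsHsiehLFunction ι' 𝔭 κ γ f A ΩK C ((Ωp : unrIntegers p) : ℂ_[p]) QH →
                  ∀ (𝔭' : HeightOneSpectrum (𝓞 K)), ((p : ℕ) : 𝓞 K) ∈ 𝔭'.asIdeal → 𝔭' ≠ 𝔭 →
                  Module.IsTorsion (IwasawaAlgebra p) (XAc (W.baseChange K) p κ 𝔭' ∅ γ) →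
                  ∀ (d₀ : ℤ) (r : AlgebraicClosure K) (ψ : (W.baseChange K).geomPoints →+ (W.baseChange K).geomPoints),
                    r * r = algebraMap K (AlgebraicClosure K) (d₀ : K) →
                    r ∉ Set.range (algebraMap K (AlgebraicClosure K)) →
                    (∀ y : ZMod p, y * y ≠ PadicInt.toZMod ((d₀ : ℤ) : ℤ_[p])) →
                    (∀ σ : absoluteGaloisGroup K, σ • r = r → ∀ P : (W.baseChange K).geomPoints, σ • ψ P = ψ (σ • P)) →
                    (∀ σ : absoluteGaloisGroup K, σ • r = -r → ∀ P : (W.baseChange K).geomPoints, σ • ψ P = -ψ (σ • P)) →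
                    (∀ P, ψ (ψ P) = d₀ • P) →
                  ∀ (U : Subgroup (absoluteGaloisGroup K)) [U.Normal], (∀ σ, σ ∈ U ↔ σ • r = r) →
                  ∀ (φ : (W.baseChange K).geomPrimaryTorsion p →+ (W.baseChange K).geomPrimaryTorsion p)
                    (_ : ∀ m, ((φ m : (W.baseChange K).geomPrimaryTorsion p) : (W.baseChange K).geomPoints) = ψ m)
                    (hφH' : ∀ (x : (κ.kerSubgroup ⊓ U : Subgroup (absoluteGaloisGroup K)))
                      (m : (W.baseChange K).geomPrimaryTorsion p), φ (x • m) = x • φ m)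
                    (hφU : ∀ σ ∈ U, ∀ m : (W.baseChange K).geomPrimaryTorsion p, φ (σ • m) = σ • φ m)
                    (hφU' : ∀ σ, σ ∉ U → ∀ m : (W.baseChange K).geomPrimaryTorsion p, φ (σ • m) = -(σ • φ m))
                    (hφ2 : ∀ m, φ (φ m) = d₀ • m)
                    (γ' : absoluteGaloisGroup K) (_ : κ.IsTopGenerator γ') (_ : γ' ∈ U)
                    (f₁ : AddMonoid.End (selmerOver (κ.kerSubgroup ⊓ U) ((W.baseChange K).geomPrimaryTorsion p) p 𝔭' ∅))
                    (_hf : ∀ s, ((f₁ s : selmerOver (κ.kerSubgroup ⊓ U) ((W.baseChange K).geomPrimaryTorsion p) p 𝔭' ∅) :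
                      subgroupH1 (κ.kerSubgroup ⊓ U) ((W.baseChange K).geomPrimaryTorsion p)) =
                        conjH1 (κ.kerSubgroup ⊓ U) ((W.baseChange K).geomPrimaryTorsion p) γ' s)
                    (h : IsLocNil p (f₁ - 1))
                    (δ : LocNilDual (selmerOver (κ.kerSubgroup ⊓ U) ((W.baseChange K).geomPrimaryTorsion p) p 𝔭' ∅) f₁ h
                      →ₗ[IwasawaAlgebra p]
                      LocNilDual (selmerOver (κ.kerSubgroup ⊓ U) ((W.baseChange K).geomPrimaryTorsion p) p 𝔭' ∅) f₁ h)
                    (hδ : ∀ (x : LocNilDual (selmerOver (κ.kerSubgroup ⊓ U) ((W.baseChange K).geomPrimaryTorsion p) p 𝔭' ∅) f₁ h)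
                      (s t : selmerOver (κ.kerSubgroup ⊓ U) ((W.baseChange K).geomPrimaryTorsion p) p 𝔭' ∅),
                      (t : subgroupH1 (κ.kerSubgroup ⊓ U) ((W.baseChange K).geomPrimaryTorsion p)) =
                        resH1Hom (ContinuousMonoidHom.id _) φ hφH'
                          (s : subgroupH1 (κ.kerSubgroup ⊓ U) ((W.baseChange K).geomPrimaryTorsion p)) → δ x s = x t)
                    (b : Module.Basis (Fin 2) ℤ_[p]
                      (AdjoinRoot (Polynomial.X ^ 2 - Polynomial.C ((d₀ : ℤ) : ℤ_[p]) : Polynomial ℤ_[p]))) (hb0 : b 0 = 1)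
                    (hb1 : b 1 * b 1 = algebraMap ℤ_[p]
                      (AdjoinRoot (Polynomial.X ^ 2 - Polynomial.C ((d₀ : ℤ) : ℤ_[p]) : Polynomial ℤ_[p])) ((d₀ : ℤ) : ℤ_[p]))
                    (ι : AdjoinRoot (Polynomial.X ^ 2 - Polynomial.C ((d₀ : ℤ) : ℤ_[p]) : Polynomial ℤ_[p]) →+* 𝓞_ℂ_[p])
                    (_ : ι.comp (algebraMap ℤ_[p] _) = R1.toCpInt p),
                    ∃ m : ℕ, ∀ x ∈ (charIdeal (PowerSeries
                        (AdjoinRoot (Polynomial.X ^ 2 - Polynomial.C ((d₀ : ℤ) : ℤ_[p]) : Polynomial ℤ_[p])))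
                        (WithQuadratic (LocNilDual (selmerOver (κ.kerSubgroup ⊓ U) ((W.baseChange K).geomPrimaryTorsion p)
                          p 𝔭' ∅) f₁ h) b hb0 hb1 δ
                          (delta_sq (W.baseChange K) κ 𝔭' ∅ U φ hφH' hφU hφU' d₀ hφ2 f₁ h δ hδ))).map (PowerSeries.map ι),
                      (PowerSeries.C ((p : ℕ) : 𝓞_ℂ_[p]) : PowerSeries 𝓞_ℂ_[p]) ^ m * x ∈ Ideal.span {QH} := by
  sorry

/-- COMPOSITION (kernel-checked): the crux `EisensteinHeartFlatCMInertBadKPrime` — THE ROUTE DECL BY NAME — from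
`stub_hsiehWitness`, `stub_sqrtEndomorphism` and `stub_V4`: Hsieh witness `Q_H` → `[√d₀]` datum → `U := Stab(r)` (open, normal,
index 2) → w1's one-call V3 `…CMDatumAdapter.heartShape_xac_of_sqrt_endomorphism` with `hV4 := stub_V4` (`X_ac` f.g. by
`XAc.module_finite_empty`) → heart shape for `(X_ac, Q_H)` → the given ♭-frame `Q` by the PROVED ideal rigidity
`X11b.span_singleton_eq_of_isHsiehLFunction_of_isBDPLFunctionInt` (`p ∣ N_W` since `p` is bad, `p ≠ 2` since `p ≥ 5`). -/
theorem EisensteinHeartFlatCMInertBadKPrime_of : EisensteinHeartFlatCMInertBadKPrime := by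
  intro W _ _ p _ _ K _ _ hCM _hr hp5 hin hbad hK hHN hd4 hh _hLt κ hκ γ _ 𝔭 h𝔭 he hf1 f hf ι' hι ΩK Ωp Q hΩK
    hQ 𝔭' h𝔭' hne htors
  have hp : p.Prime := Fact.out
  have hp2 : p ≠ 2 := by omega
  have hpN : p ∣ W.conductorNorm ℤ := (W.dvd_conductorNorm_iff_not_hasGoodReductionAtPrime p).mpr hbad
  have hγ : κ.IsTopGenerator γ := Fact.out
  -- a Hsieh witness of the same `(ι′, 𝔭, κ, γ, f)`
  obtain ⟨A, ΩK₁, C, Ωp₁, QH, hA, hΩK₁, hC, hQH⟩ :=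
    stub_hsiehWitness W p K hp5 hbad hK hHN κ hκ γ 𝔭 h𝔭 f hf ι' hι
  -- the CM endomorphism `[√d₀]` over `K′` and the index-two subgroup `U = Γ_L`
  obtain ⟨d₀, r, ψ, hr, hrK, hd, hψU, hψU', hψ2⟩ := stub_sqrtEndomorphism W p K hCM hp5 hin hbad hK hHN 𝔭 𝔭' h𝔭 h𝔭' hne
  let U : Subgroup (absoluteGaloisGroup K) := MulAction.stabilizer (absoluteGaloisGroup K) r
  have hUr : ∀ σ, σ ∈ U ↔ σ • r = r := fun σ ↦ MulAction.mem_stabilizer_iff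
  haveI : U.Normal := normal_of_forall_mem_iff r (d₀ : K) hr hrK U hUr
  haveI : (W.baseChange K).IsElliptic := inferInstanceAs (W.map (algebraMap ℚ K)).IsElliptic
  haveI : Module.Finite (IwasawaAlgebra p) (XAc (W.baseChange K) p κ 𝔭' ∅ γ) := XAc.module_finite_empty κ 𝔭' γ
  -- V3 (Shapiro, one call) + THE INPUT for the upper module
  have hdiv : ∃ m : ℕ, ∀ x ∈ (XAc.charIdeal (W.baseChange K) p κ 𝔭' ∅ γ).map (PowerSeries.map (R1.toCpInt p)),
      (PowerSeries.C ((p : ℕ) : 𝓞_ℂ_[p]) : PowerSeries 𝓞_ℂ_[p]) ^ m * x ∈ Ideal.span {QH} :=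
    heartShape_xac_of_sqrt_endomorphism (W.baseChange K) κ 𝔭' ∅ U hp2 γ ψ d₀ r hr hrK hUr hψU hψU' hψ2 hd htors
      (stub_V4 W p K hCM hp5 hin hbad hK hHN hd4 hh κ hκ γ 𝔭 h𝔭 he hf1 f hf ι' hι A ΩK₁ C Ωp₁ QH hA hΩK₁ hC hQH
        𝔭' h𝔭' hne htors d₀ r ψ hr hrK hd hψU hψU' hψ2 U hUr)
  obtain ⟨m, hm⟩ := hdiv
  -- the witness and the ♭-frame generate the same ideal
  have hΩp₁ : ((Ωp₁ : unrIntegers p) : ℂ_[p]) ≠ 0 := by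
    rw [Ne, ZeroMemClass.coe_eq_zero]
    exact Ωp₁.ne_zero
  have hΩp : ((Ωp : unrIntegers p) : ℂ_[p]) ≠ 0 := by
    rw [Ne, ZeroMemClass.coe_eq_zero]
    exact Ωp.ne_zero
  have hideal : Ideal.span ({QH} : Set (PowerSeries (PadicComplexInt p))) = Ideal.span {Q} :=
    span_singleton_eq_of_isHsiehLFunction_of_isBDPLFunctionInt hp2 hK hκ hγ hpN hA hΩK₁ hC hΩp₁ hQH hΩK
      hΩp hQ
  refine ⟨m, fun x hx ↦ ?_⟩
  rw [← hideal]
  exact hm x hx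

end Summit.BirchSwinnertonDyer.BirchSwinnertonDyer.Cruxes.EisensteinHeartFlatCMInertBadKPrime.HsiehLambda

end
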